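import Summits.KontsevichZagierPeriods.KontsevichZagierPeriods.Theorems.GammaHodgeSector.Negative.LoadBearing
import Summits.KontsevichZagierPeriods.KontsevichZagierPeriods.Theorems.BetaCancellation.Negative.PiLink
import Literature.NumberTheory.Transcendental.KZRulesAssociator
import Literature.NumberTheory.Transcendental.KZMellinFibres
import Literature.NumberTheory.Transcendental.KZRelationsLE
import Literature.NumberTheory.Transcendental.BetaSymbolGroup

/-!
# `GammaHodgeSector` (stmt-KontsevichZagierPeriods-3742), line `koblitz-ogus-halving` — definitions

Objects posited by the line (lead's reduction skeleton over the formal period ring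
`P = KZ.FormalPeriodRing` of `KZRulesAssociator.lean`):

* `betaRep a b` — the Beta representation `[(0,1), t^{a−1}(1−t)^{b−1}]` on `ℝ¹` (`0 < a, b`),
  `IsBetaRep` (pinning predicate), `betaClass a b ∈ P` (total, junk `1` off `0 < a, b`),
  `prodClass` of a Beta word;
* `kap q = ⟦[pt, q]⟧ ∈ P` for real algebraic `q` (a unit of `P` when `q ≠ 0`) and
  `IsConstMultiple p p'` (`p = κ(q) p'`, `q > 0` algebraic);
(No closed `Prop` is posited here: "all relators hold", the cube/ball product statements and the
line's axiom `PositiveRoots` are spelled out inside the registered stub signatures of the skeleton.)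
§3 proves the registered stub `stub_realisation` (Beta classes are non-zero-divisors of `P` under
`BetaCancellation`; localisation at them turns `RelSpan`-congruent words into constant multiples).

All definitions are real; the API lemmas below are proved. No named fact is introduced.
References: Kontsevich–Zagier 2001 §1.1–1.2, §4.1; Andrews–Askey–Roy 1999 §1.1.
-/

noncomputable section

open MeasureTheory Set
open scoped BigOperators

namespace Summit.KontsevichZagierPeriods.GammaHodgeSectorKO

open Literature.NumberTheory.Transcendental
open Literature.NumberTheory.Transcendental.KZ
open Literature.NumberTheory.Transcendental.BetaSymbol
open Literature.ModelTheory.ExponentialFields (IsSemialgebraic)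
open Literature.NumberTheory.Transcendental.KZreg (unitIoo isSemialgebraic_unitIoo)
open Summit.KontsevichZagierPeriods.GammaHodgeSectorNegative (IsCubeBetaRep IsBallCubeRep)
open Summit.KontsevichZagierPeriods.KontsevichZagierPeriods.BetaCancellationNegative
  (betaKernel KernelCancellation IsPinned betaCancellation_iff isPinned_prod betaHalfRep
   equivalent_betaHalfRep_piRep integrableOn_betaKernel_and_integral_eq integral_betaKernel_pos
   integrableOn_comp_apply_zero_iff mem_unitIoo)
open Summit.KontsevichZagierPeriods.KontsevichZagierPeriods.Theses.TerasomaMultiplication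
  (MultiplicationAccessible BetaCancellation)

/-! ## §1 Beta representations, their classes in `P`, constants -/

/-- The Beta representation `β(a,b) = [(0,1), t^{a−1}(1−t)^{b−1}]` on `ℝ¹` (`0 < a, b ∈ ℚ`).
[cite: KontsevichZagier2001, §1.1] -/
def betaRep (a b : ℚ) (ha : 0 < a) (hb : 0 < b) : IntegralRep 1 where
  domain := unitIoo
  integrand := fun x => betaKernel a b (x 0)
  isSemialgebraic_domain := isSemialgebraic_unitIoo
  isSemialgebraicFunOn_integrand := by
    have h := isSemialgebraicFunOn_mellinIntegrand isSemialgebraic_unitIoo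
      ![(MvPolynomial.X 0 : MvPolynomial (Fin 1) ℚ), 1 - MvPolynomial.X 0] ![a - 1, b - 1] 1
      (fun x hx k => by
        rw [mem_unitIoo] at hx
        fin_cases k <;> simp [hx.1, hx.2])
    refine h.congr fun x _ => ?_
    simp [mellinIntegrand, Fin.prod_univ_two, betaKernel]
  integrableOn := integrableOn_comp_apply_zero_iff.2 (integrableOn_betaKernel_and_integral_eq ha hb).1

/-- The domain of `betaRep`. [folklore] -/
@[simp] theorem betaRep_domain (a b : ℚ) (ha : 0 < a) (hb : 0 < b) :
    (betaRep a b ha hb).domain = unitIoo := rfl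

/-- The integrand of `betaRep`. [folklore] -/
@[simp] theorem betaRep_integrand (a b : ℚ) (ha : 0 < a) (hb : 0 < b) :
    (betaRep a b ha hb).integrand = fun x => betaKernel a b (x 0) := rfl

/-- `(0,1) ⊆ ℝ¹` is the preimage of `(0,1)` under the first coordinate. [folklore] -/
theorem unitIoo_eq_preimage : unitIoo = (MeasurableEquiv.funUnique (Fin 1) ℝ) ⁻¹' Ioo (0:ℝ) 1 := by
  ext t; simp [KZreg.unitIoo, MeasurableEquiv.funUnique]

/-- The integrand of `betaRep` is the Beta kernel transported along `ℝ¹ ≃ ℝ`. [folklore] -/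
theorem betaKernel_apply_zero_eq_comp (a b : ℚ) :
    (fun x : Fin 1 → ℝ => betaKernel a b (x 0)) = betaKernel a b ∘ (MeasurableEquiv.funUnique (Fin 1) ℝ) := by
  funext t; simp [MeasurableEquiv.funUnique]

/-- `value β(a,b) = B(a,b)`. [folklore] -/
theorem betaRep_value (a b : ℚ) (ha : 0 < a) (hb : 0 < b) :
    (betaRep a b ha hb).value = ProbabilityTheory.beta a b := by
  rw [IntegralRep.value, betaRep_domain, betaRep_integrand,
    ← (integrableOn_betaKernel_and_integral_eq ha hb).2, unitIoo_eq_preimage,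
    betaKernel_apply_zero_eq_comp]
  exact (volume_preserving_funUnique (Fin 1) ℝ).setIntegral_preimage_emb
    (MeasurableEquiv.measurableEmbedding _) (betaKernel a b) (Ioo (0:ℝ) 1)

/-- `0 < value β(a,b)`. [folklore] -/
theorem betaRep_value_pos (a b : ℚ) (ha : 0 < a) (hb : 0 < b) : 0 < (betaRep a b ha hb).value := by
  rw [betaRep_value]
  exact ProbabilityTheory.beta_pos (by exact_mod_cast ha) (by exact_mod_cast hb)

/-- `s` is PINNED as the Beta representation `β(a,b)`: domain `(0,1)`, integrand
`t^{a−1}(1−t)^{b−1}` on it. [folklore] -/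
def IsBetaRep (a b : ℚ) (s : IntegralRep 1) : Prop :=
  s.domain = unitIoo ∧ EqOn s.integrand (fun x => betaKernel a b (x 0)) s.domain

/-- `betaRep a b` is pinned as `β(a,b)`. [folklore] -/
theorem isBetaRep_betaRep (a b : ℚ) (ha : 0 < a) (hb : 0 < b) : IsBetaRep a b (betaRep a b ha hb) :=
  ⟨rfl, fun _ _ => rfl⟩

/-- Two representations pinned as the same `β(a,b)` are equivalent (one integrand-additivity
move). [folklore] -/
theorem IsBetaRep.equivalent {a b : ℚ} {s s' : IntegralRep 1} (h : IsBetaRep a b s)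
    (h' : IsBetaRep a b s') : Equivalent s s' :=
  of_sub_of_mem_relations_of_eqOn (h'.1.trans h.1.symm)
    fun _ hx => (h.2 hx).trans (h'.2 (h'.1.symm ▸ h.1 ▸ hx)).symm

/-- The class `β(a,b) ∈ P` of the Beta representation (junk value `1` unless `0 < a, b`). [folklore] -/
def betaClass (a b : ℚ) : FormalPeriodRing :=
  if h : 0 < a ∧ 0 < b then toFormalPeriod (of (betaRep a b h.1 h.2)) else 1

/-- For `0 < a, b`, `betaClass a b` is the class of `betaRep a b`. [folklore] -/
theorem betaClass_eq (a b : ℚ) (ha : 0 < a) (hb : 0 < b) :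
    betaClass a b = toFormalPeriod (of (betaRep a b ha hb)) := by
  rw [betaClass, dif_pos ⟨ha, hb⟩]

/-- A pinned `β(a,b)` has class `betaClass a b`. [folklore] -/
theorem IsBetaRep.toFormalPeriod_eq {a b : ℚ} (ha : 0 < a) (hb : 0 < b) {s : IntegralRep 1}
    (h : IsBetaRep a b s) : toFormalPeriod (of s) = betaClass a b := by
  rw [betaClass_eq a b ha hb]
  exact (h.equivalent (isBetaRep_betaRep a b ha hb)).toFormalPeriod_eq

/-- `evalP (betaClass a b) = B(a,b)` for `0 < a, b`. [folklore] -/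
theorem evalP_betaClass (a b : ℚ) (ha : 0 < a) (hb : 0 < b) :
    evalP (betaClass a b) = ProbabilityTheory.beta a b := by
  rw [betaClass_eq a b ha hb, evalP_toFormalPeriod_of, betaRep_value]

/-- The constant `κ(q) = ⟦[pt, q]⟧ ∈ P` for a real algebraic `q`. [cite: KontsevichZagier2001, §1.1] -/
def kap (q : ℝ) (hq : IsAlgebraic ℚ q) : FormalPeriodRing :=
  toFormalPeriod (of (IntegralRep.unit.constMul q hq))

/-- `evalP κ(q) = q`. [folklore] -/
@[simp] theorem evalP_kap (q : ℝ) (hq : IsAlgebraic ℚ q) : evalP (kap q hq) = q := by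
  rw [kap, evalP_toFormalPeriod_of, IntegralRep.value_constMul, IntegralRep.value_unit, mul_one]

/-- `p` is a POSITIVE-CONSTANT MULTIPLE of `p'`: `p = κ(q) · p'` for a positive real algebraic `q`.
[folklore] -/
def IsConstMultiple (p p' : FormalPeriodRing) : Prop :=
  ∃ (q : ℝ) (hq : IsAlgebraic ℚ q), 0 < q ∧ p = kap q hq * p'

/-! ## §2 Words and their classes in `P` -/

/-- The class in `P` of a Beta word: the product of its Beta classes. [folklore] -/
def prodClass (m : Multiset (ℚ × ℚ)) : FormalPeriodRing := (m.map fun p => betaClass p.1 p.2).prod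

/-! ### Constants: `κ` is multiplicative -/

/-- `κ(q) = κ(q')` when `q = q'` (proof-irrelevance helper). [folklore] -/
theorem kap_congr {q q' : ℝ} (hq : IsAlgebraic ℚ q) (hq' : IsAlgebraic ℚ q') (h : q = q') :
    kap q hq = kap q' hq' := by
  subst h; rfl

/-- `κ(1) = 1`. [folklore] -/
theorem kap_one : kap 1 isAlgebraic_one = 1 := by
  rw [kap, ← toFormalPeriod_of_unit]
  congr 1
  exact congrArg of (IntegralRep.ext' rfl (by funext x; simp))

/-- `κ(ab) = κ(a)κ(b)`: the product of two point representations is a point representation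
(a relabelling away from `[pt, ab]`). [folklore] -/
theorem kap_mul (a b : ℝ) (ha : IsAlgebraic ℚ a) (hb : IsAlgebraic ℚ b) :
    kap (a * b) (ha.mul hb) = kap a ha * kap b hb := by
  rw [kap, kap, kap, toFormalPeriod_of_mul_of]
  apply toFormalPeriod_eq_iff.mpr
  refine of_sub_of_mem_relations_of_eqOn ?_ ?_
  · ext z
    simp [IntegralRep.prod_domain, IntegralRep.prodDomain]
  · intro z _
    rw [IntegralRep.prod_integrand_eq]
    simp [IntegralRep.prodFun]

/-- `κ(a^n) = κ(a)^n`. [folklore] -/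
theorem kap_pow (a : ℝ) (ha : IsAlgebraic ℚ a) (n : ℕ) : kap (a ^ n) (ha.pow n) = kap a ha ^ n := by
  induction n with
  | zero => simpa using kap_one
  | succ n ih =>
    rw [pow_succ (kap a ha), ← ih, ← kap_mul]
    exact kap_congr _ _ (pow_succ a n)

/-- `κ(a)κ(a⁻¹) = 1` for `a ≠ 0`: constants are units of `P`. [folklore] -/
theorem kap_mul_kap_inv {a : ℝ} (ha : IsAlgebraic ℚ a) (h0 : a ≠ 0) :
    kap a ha * kap a⁻¹ ha.inv = 1 := by
  rw [← kap_mul, ← kap_one]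
  exact kap_congr _ _ (mul_inv_cancel₀ h0)

/-! ### Products of Beta classes -/

/-- `prodClass` of a singleton. [folklore] -/
@[simp] theorem prodClass_singleton (p : ℚ × ℚ) : prodClass {p} = betaClass p.1 p.2 := by
  simp [prodClass]

/-- `prodClass` of a cons. [folklore] -/
@[simp] theorem prodClass_cons (p : ℚ × ℚ) (m : Multiset (ℚ × ℚ)) :
    prodClass (p ::ₘ m) = betaClass p.1 p.2 * prodClass m := by
  simp [prodClass]

/-- `prodClass 0 = 1`. [folklore] -/
@[simp] theorem prodClass_zero : prodClass 0 = 1 := by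
  simp [prodClass]

/-- `prodClass` is multiplicative. [folklore] -/
theorem prodClass_add (m m' : Multiset (ℚ × ℚ)) : prodClass (m + m') = prodClass m * prodClass m' := by
  simp [prodClass, Multiset.prod_add]

/-- `prodClass (n • m) = (prodClass m)^n`. [folklore] -/
theorem prodClass_nsmul (n : ℕ) (m : Multiset (ℚ × ℚ)) : prodClass (n • m) = prodClass m ^ n := by
  simp [prodClass, Multiset.map_nsmul, Multiset.prod_nsmul]

/-- The class of the word multiset is the product of the Beta classes. [folklore] -/
theorem prodClass_wordMultiset {N : ℕ} (x y : Fin N → ℚ) :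
    prodClass (wordMultiset x y) = ∏ j, betaClass (x j) (y j) := by
  simp only [prodClass, wordMultiset, Multiset.map_map, Function.comp_def]
  rfl

/-- `IsConstMultiple` with constant `1`. [folklore] -/
theorem isConstMultiple_of_eq {p p' : FormalPeriodRing} (h : p = p') : IsConstMultiple p p' :=
  ⟨1, isAlgebraic_one, one_pos, by rw [kap_one, one_mul, h]⟩

/-- `evalP` of a product of Beta classes of positive data is positive. [folklore] -/
theorem evalP_prod_betaClass_pos {N : ℕ} (x y : Fin N → ℚ) (h : ∀ j, 0 < x j ∧ 0 < y j) :
    0 < evalP (∏ j, betaClass (x j) (y j)) := by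
  rw [map_prod]
  refine Finset.prod_pos fun j _ => ?_
  rw [evalP_betaClass _ _ (h j).1 (h j).2]
  exact ProbabilityTheory.beta_pos (by exact_mod_cast (h j).1) (by exact_mod_cast (h j).2)

/-- `evalP β(½,½)^k > 0`. [folklore] -/
theorem evalP_betaHalf_pow_pos (k : ℕ) : 0 < evalP (betaClass (1 / 2) (1 / 2) ^ k) := by
  rw [map_pow, evalP_betaClass _ _ (by norm_num) (by norm_num)]
  exact pow_pos (ProbabilityTheory.beta_pos (by norm_num) (by norm_num)) k


/-! ## §3 Realisation (registered stub `stub_realisation`): Beta classes are non-zero-divisors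
(`BetaCancellation`), so symbol relations become identities in `P` up to positive constants -/

section Realisation

open Summit.KontsevichZagierPeriods.KontsevichZagierPeriods.BetaCancellationNegative
  (betaCancellation_iff isPinned_prod)

/-! ### Realisation: from `RelSpan` to identities in `P` up to constants -/

/-- **Beta classes are non-zero-divisors of the formal period ring** under `BetaCancellation`:
if `β(a,b) · p = 0` in `P`, write `p = ⟦[r]⟧ − ⟦[r']⟧` (`KZ.exists_integralRep_sub_holds`); then
`[β(a,b)] × r ∼ [β(a,b)] × r'` are pinned over `r`, `r'` with the Beta kernel, so `r ∼ r'` by the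
kernel form of the crux, i.e. `p = 0`. (Off `0 < a, b` the class is the junk value `1`.)
[folklore] -/
theorem betaClass_mem_nonZeroDivisors (hB : BetaCancellation) (a b : ℚ) :
    betaClass a b ∈ nonZeroDivisors FormalPeriodRing := by
  by_cases hab : 0 < a ∧ 0 < b
  · obtain ⟨ha, hb⟩ := hab
    rw [betaClass_eq a b ha hb, mem_nonZeroDivisors_iff_left]
    intro p hp
    obtain ⟨c, rfl⟩ := toFormalPeriod_surjective p
    obtain ⟨n, m, r, r', hc⟩ := exists_integralRep_sub_holds c
    have hc' : toFormalPeriod c = toFormalPeriod (of r) - toFormalPeriod (of r') := by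
      rw [← map_sub]
      exact toFormalPeriod_eq_iff.mpr hc
    rw [hc', mul_sub, toFormalPeriod_of_mul_of, toFormalPeriod_of_mul_of, sub_eq_zero] at hp
    have hqq' : Equivalent ((betaRep a b ha hb).prod r) ((betaRep a b ha hb).prod r') :=
      toFormalPeriod_eq_iff.mp hp
    have hrr' : Equivalent r r' :=
      betaCancellation_iff.mp hB a b ha hb r r' _ _
        (isPinned_prod (betaRep a b ha hb) rfl (fun _ _ => rfl) r)
        (isPinned_prod (betaRep a b ha hb) rfl (fun _ _ => rfl) r') hqq'
    rw [hc', sub_eq_zero]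
    exact hrr'.toFormalPeriod_eq
  · rw [betaClass, dif_neg hab]
    exact one_mem _

/-- **Realisation.** If the standard relators hold in `P` up to positive constants and Beta
classes cancel (`BetaCancellation`), then two Beta words whose symbols are congruent modulo
`RelSpan` have classes that agree up to a positive algebraic constant. Proof: Beta classes are
non-zero-divisors, hence units of the total ring of fractions `Frac P`, into which `P` embeds; the
symbol map lifts to a homomorphism `BSym → (Frac P)ˣ` sending `msym m` to `prodClass m`, and it maps
`RelSpan` into the subgroup of positive algebraic constants `κ(q)` (which are units of `P`).
[folklore] -/
theorem stub_realisation (hB : BetaCancellation)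
    (hrel : ∀ p ∈ relatorPairs, IsConstMultiple (prodClass p.1) (prodClass p.2))
    (m₁ m₂ : Multiset (ℚ × ℚ))
    (h : msym m₁ - msym m₂ ∈ RelSpan) : IsConstMultiple (prodClass m₁) (prodClass m₂) := by
  -- the total ring of fractions of `P` and the (injective) structure map
  set L : Type := FractionRing FormalPeriodRing
  set ι : FormalPeriodRing →+* L := algebraMap FormalPeriodRing L
  have hι : Function.Injective ι := IsFractionRing.injective FormalPeriodRing L
  have hunit : ∀ ab : ℚ × ℚ, IsUnit (ι (betaClass ab.1 ab.2)) := fun ab =>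
    IsLocalization.map_units L ⟨betaClass ab.1 ab.2, betaClass_mem_nonZeroDivisors hB ab.1 ab.2⟩
  -- the symbol map lifted to the units of `L`
  obtain ⟨Φ, hΦof⟩ : ∃ Φ : BSym →+ Additive Lˣ,
      ∀ ab : ℚ × ℚ, Φ (bsym ab.1 ab.2) = Additive.ofMul (hunit ab).unit :=
    ⟨FreeAbelianGroup.lift fun ab => Additive.ofMul (hunit ab).unit,
      fun ab => FreeAbelianGroup.lift_apply_of _ _⟩
  have hΦ : ∀ m : Multiset (ℚ × ℚ), ((Additive.toMul (Φ (msym m)) : Lˣ) : L) = ι (prodClass m) := by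
    intro m
    induction m using Multiset.induction_on with
    | empty => rw [msym_zero, map_zero, toMul_zero, Units.val_one, prodClass_zero, map_one]
    | cons p m ih =>
      rw [msym_cons, map_add, toMul_add, Units.val_mul, ih, prodClass_cons, map_mul,
        hΦof (p.1, p.2), toMul_ofMul, IsUnit.unit_spec]
  -- `Φ` maps `RelSpan` into the positive algebraic constants
  have key : ∀ v ∈ RelSpan, ∃ (q : ℝ) (hq : IsAlgebraic ℚ q), 0 < q ∧
      ((Additive.toMul (Φ v) : Lˣ) : L) = ι (kap q hq) := by
    intro v hv
    induction hv using AddSubgroup.closure_induction with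
    | mem v hv =>
      obtain ⟨⟨Lw, Rw⟩, hLR, rfl⟩ := hv
      obtain ⟨q, hq, hq0, hEq⟩ := hrel _ hLR
      refine ⟨q, hq, hq0, ?_⟩
      rw [map_sub, toMul_sub, div_eq_mul_inv, Units.val_mul, hΦ, hEq, map_mul, mul_assoc,
        ← hΦ Rw, Units.mul_inv, mul_one]
    | zero =>
      exact ⟨1, isAlgebraic_one, one_pos, by
        rw [map_zero, toMul_zero, Units.val_one, kap_one, map_one]⟩
    | add v w _ _ ihv ihw =>
      obtain ⟨q₁, hq₁, h₁, e₁⟩ := ihv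
      obtain ⟨q₂, hq₂, h₂, e₂⟩ := ihw
      exact ⟨q₁ * q₂, hq₁.mul hq₂, mul_pos h₁ h₂, by
        rw [map_add, toMul_add, Units.val_mul, e₁, e₂, kap_mul, map_mul]⟩
    | neg v _ ih =>
      obtain ⟨q, hq, h0, e⟩ := ih
      refine ⟨q⁻¹, hq.inv, inv_pos.mpr h0, ?_⟩
      rw [map_neg, toMul_neg]
      exact Units.inv_eq_of_mul_eq_one_right
        (by rw [e, ← map_mul, kap_mul_kap_inv hq h0.ne', map_one])
  -- conclude by injectivity of `ι`
  obtain ⟨q, hq, hq0, e⟩ := key _ h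
  refine ⟨q, hq, hq0, hι ?_⟩
  rw [map_mul, ← e, ← hΦ m₁, ← hΦ m₂, map_sub, toMul_sub, ← Units.val_mul, div_mul_cancel]

end Realisation

end Summit.KontsevichZagierPeriods.GammaHodgeSectorKO
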